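import Literature.Probability.LatticeModels.PolymerPressure
import HarnessLib

/-!
# Anchored cluster expansions of subset-polymer gases on an arbitrary site set

Kotecký–Preiss (1986) bookkeeping for EXPECTATIONS OF LOCAL OBSERVABLES (as opposed to the
pressure, `PolymerPressure.lean`): the logarithm of a ratio of two polymer partition functions
whose activities differ only on "anchored" polymers (those carrying the observable / the source)
is the sum of the truncated functionals of the clusters meeting an anchored polymer
([KP86] Proposition (i), eq. (5); Ueltschi 1999, proof of Thm. 2.1 (ii): "`⟨K⟩ = lim Σ_{𝒜_K ⊃ K}
ρ_K(𝒜_K) exp{-Σ_{C, C ∩ 𝒜_K ≠ ∅} Φ^T(C)}` … The limit exists, because the sums converge uniformly in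
the volume"). This file provides the volume-INDEPENDENT part of that argument for subset polymers
`A : Finset α` of an ARBITRARY site type `α` (a torus, a box, `ℤ^d`), incompatible iff equal or
intersecting (`polyInc`):

* `IsSmallActivity ρ δ` — one-site Kotecký–Preiss smallness `Σ_{A ∋ x} |ρ(A)| e^{(1+δ)|A|} ≤ 1`
  with `ρ ∅ = 0`, `δ > 0` (the tree's `IsSmallTIActivity` of `PolymerPressure.lean` minus
  translation invariance and the `ℤ^d`-connectivity, which play no role here); its consequences
  `kp_hypothesis` (hypothesis (1) of [KP86] with `a = |·|`, `d = δ|·|`), `isKPVolume`,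
  `exp_polymerLogZ` (the KP branch IS a logarithm of `Ξ`, which never vanishes),
  `isPolymerCluster_of_ne_zero`, `ne_zero_of_mem_of_ne_zero`, and the **anchored tail bound**
  `sum_norm_truncatedWeight_anchored_ge_le`: `Σ_{C : x ∈ ⋃C, ‖C‖ ≥ R} |Φ^T(C)| ≤ e^{-δR}` for every
  finite family of families (`‖C‖ = Σ_{A ∈ C} |A|`; estimate (4) of [KP86] at the polymer `{x}`);
* `polymerLogZ_sub_eq_sum_filter` — **the anchored difference formula**: if `w = w'` off a set `T`
  of polymers of the volume `𝒱`, then `log Ξ_𝒱(w) - log Ξ_𝒱(w') = Σ_{C ⊆ 𝒱, C ∩ T ≠ ∅} (Φ^T(C; w) - Φ^T(C; w'))`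
  ([KP86] (2) and locality of `Φ^T`; no smallness needed);
* geometry of anchored clusters for an arbitrary "step" relation `R` on the sites:
  `reflTransGen_clusterSupp_of_isPolymerCluster'` (supports of clusters of `R`-connected polymers
  are `R`-connected — the tree's `reflTransGen_clusterSupp_of_isPolymerCluster` for a general `R`),
  `height_succ_le_card_of_reflTransGen` (**discrete intermediate values** for a height function
  that grows by at most one along `R`: an `R`-connected set through a site of height `0` and a
  site of height `h` has `≥ h + 1` sites) and the packaging `height_lt_of_mem_clusterSupp`:
  every site of the support of a family `C` through `x` with `Φ^T(C) ≠ 0` has height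
  `< ‖C‖` — so anchored clusters of bounded size stay in a bounded region, where the clusters of
  two different volumes can be identified (`truncatedWeight_image` of `ClusterExpansion.lean`).

Everything is PROVED; no named fact is introduced (the Kotecký–Preiss estimate enters through
the discharged `koteckyPreiss_truncatedWeight_bound_holds`).

## References

* [KP86] R. Kotecký, D. Preiss, Comm. Math. Phys. 103 (1986) 491–498: Theorem p. 492 with (1), (2),
  (4); Proposition p. 494 (i), eq. (5). [KoteckyPreiss1986]
* D. Ueltschi, J. Stat. Phys. 95 (1999) 693, proof of Thm. 2.1 (ii) (arXiv p. 5). [Ueltschi1999]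
-/

noncomputable section

namespace Literature.Probability.LatticeModels

open Finset

/-! ### The anchored difference formula (no smallness) -/

section Difference

variable {P : Type*} [DecidableEq P] {inc : P → P → Prop} [DecidableRel inc]

/-- **The anchored difference formula.** If two activities agree on the polymers of `𝒱` outside
`T`, then `log Z(𝒱; w) - log Z(𝒱; w') = Σ_{C ⊆ 𝒱, C ∩ T ≠ ∅} (Φ^T(C; w) - Φ^T(C; w'))` for the
Kotecký–Preiss branches: by (2) both logarithms are sums of truncated functionals over `C ⊆ 𝒱`,
and `Φ^T(C)` only depends on the activities on `C`. [cite: KoteckyPreiss1986, (2) and Proposition p. 494 (i)] -/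
theorem polymerLogZ_sub_eq_sum_filter {w w' : P → ℂ} (𝒱 T : Finset P) (h : ∀ γ ∈ 𝒱, γ ∉ T → w γ = w' γ) :
    polymerLogZ inc w 𝒱 - polymerLogZ inc w' 𝒱 =
      ∑ C ∈ 𝒱.powerset with (C ∩ T).Nonempty, (truncatedWeight inc w C - truncatedWeight inc w' C) := by
  rw [polymerLogZ_eq_sum_truncatedWeight, polymerLogZ_eq_sum_truncatedWeight, ← Finset.sum_sub_distrib,
    ← Finset.sum_filter_add_sum_filter_not 𝒱.powerset (fun C => (C ∩ T).Nonempty)]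
  conv_rhs => rw [← add_zero (∑ C ∈ 𝒱.powerset with (C ∩ T).Nonempty, _)]
  congr 1
  refine Finset.sum_eq_zero fun C hC => ?_
  obtain ⟨hC𝒱, hCT⟩ := Finset.mem_filter.1 hC
  rw [sub_eq_zero]
  refine truncatedWeight_congr fun γ hγ => h γ (Finset.mem_powerset.1 hC𝒱 hγ) fun hγT => hCT ?_
  exact ⟨γ, Finset.mem_inter.2 ⟨hγ, hγT⟩⟩

end Difference

/-! ### Small activities on the subset polymers of an arbitrary site set -/

section Small

variable {α : Type*} [DecidableEq α]

/-- **Small activities** on the subset polymers of `α`, in one-site Kotecký–Preiss form: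
`ρ ∅ = 0`, `δ > 0`, and `Σ_{A ∋ x} |ρ(A)| e^{(1+δ)|A|} ≤ 1` for every finite family of polymers
through a site `x` (hypothesis (1) of [KP86] with `a = |·|`, `d = δ|·|` at the polymer `{x}`).
[cite: KoteckyPreiss1986, Theorem p. 492, hypothesis (1)] -/
structure IsSmallActivity (ρ : Finset α → ℂ) (δ : ℝ) : Prop where
  /-- the empty polymer carries no activity -/
  rho_empty : ρ ∅ = 0
  /-- the decay rate is positive -/
  delta_pos : 0 < δ
  /-- the one-site Kotecký–Preiss smallness -/
  sum_le_one : ∀ (x : α) (𝒜 : Finset (Finset α)), (∀ A ∈ 𝒜, x ∈ A) →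
    ∑ A ∈ 𝒜, ‖ρ A‖ * Real.exp ((1 + δ) * A.card) ≤ 1

namespace IsSmallActivity

variable {ρ : Finset α → ℂ} {δ : ℝ}

/-- Hypothesis (1) of [KP86] with `a(A) = |A|`, `d(A) = δ|A|`: for every polymer `γ`,
`Σ_{γ' ι γ} |ρ(γ')| e^{|γ'| + δ|γ'|} ≤ |γ|` (sum over ALL polymers incompatible with `γ`,
absolutely convergent). [cite: KoteckyPreiss1986, Theorem p. 492, hypothesis (1)] -/
theorem kp_hypothesis (h : IsSmallActivity ρ δ) (γ : Finset α) :
    Summable (fun γ' : {γ' : Finset α // polyInc γ' γ} =>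
        ‖ρ γ'‖ * Real.exp ((γ' : Finset α).card + δ * (γ' : Finset α).card)) ∧
      ∑' γ' : {γ' : Finset α // polyInc γ' γ},
        ‖ρ γ'‖ * Real.exp ((γ' : Finset α).card + δ * (γ' : Finset α).card) ≤ γ.card := by
  set f : {γ' : Finset α // polyInc γ' γ} → ℝ := fun γ' =>
    ‖ρ γ'‖ * Real.exp ((γ' : Finset α).card + δ * (γ' : Finset α).card) with hf
  have hnn : ∀ x, 0 ≤ f x := fun x => mul_nonneg (norm_nonneg _) (Real.exp_nonneg _)
  -- bound on finite partial sums
  have key : ∀ S : Finset {γ' : Finset α // polyInc γ' γ}, ∑ x ∈ S, f x ≤ γ.card := by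
    intro S
    set 𝒜 : Finset (Finset α) := (S.map (Function.Embedding.subtype _)).filter fun A => A.Nonempty with h𝒜
    have hterm : ∀ A : Finset α, ‖ρ A‖ * Real.exp ((A.card : ℝ) + δ * A.card) =
        ‖ρ A‖ * Real.exp ((1 + δ) * A.card) := fun A => by ring_nf
    calc ∑ x ∈ S, f x
        = ∑ A ∈ S.map (Function.Embedding.subtype _), ‖ρ A‖ * Real.exp ((1 + δ) * A.card) := by
          rw [Finset.sum_map]
          exact Finset.sum_congr rfl fun x _ => hterm x
      _ = ∑ A ∈ 𝒜, ‖ρ A‖ * Real.exp ((1 + δ) * A.card) := by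
          rw [h𝒜, Finset.sum_filter]
          refine Finset.sum_congr rfl fun A _ => ?_
          split_ifs with hA
          · rfl
          · rw [Finset.not_nonempty_iff_eq_empty.1 hA, h.rho_empty, norm_zero, zero_mul]
      _ ≤ ∑ x ∈ γ, ∑ A ∈ 𝒜 with x ∈ A, ‖ρ A‖ * Real.exp ((1 + δ) * A.card) := by
          have hcover : ∀ A ∈ 𝒜, ∃ x ∈ γ, x ∈ A := by
            intro A hA
            rw [h𝒜, Finset.mem_filter, Finset.mem_map] at hA
            obtain ⟨⟨y, hy, rfl⟩, hne⟩ := hA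
            rcases y.2 with hEq | ⟨x, hx⟩
            · obtain ⟨x, hx⟩ := hne
              exact ⟨x, hEq ▸ hx, hx⟩
            · exact ⟨x, (Finset.mem_inter.1 hx).2, (Finset.mem_inter.1 hx).1⟩
          calc ∑ A ∈ 𝒜, ‖ρ A‖ * Real.exp ((1 + δ) * A.card)
              ≤ ∑ A ∈ 𝒜, ∑ x ∈ γ with x ∈ A, ‖ρ A‖ * Real.exp ((1 + δ) * A.card) := by
                refine Finset.sum_le_sum fun A hA => ?_
                rw [Finset.sum_const, nsmul_eq_mul]
                obtain ⟨x, hxγ, hxA⟩ := hcover A hA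
                have h1 : (1 : ℝ) ≤ (γ.filter fun x => x ∈ A).card := by
                  exact_mod_cast Finset.card_pos.2 ⟨x, Finset.mem_filter.2 ⟨hxγ, hxA⟩⟩
                have h0 : 0 ≤ ‖ρ A‖ * Real.exp ((1 + δ) * A.card) :=
                  mul_nonneg (norm_nonneg _) (Real.exp_nonneg _)
                nlinarith
            _ = ∑ x ∈ γ, ∑ A ∈ 𝒜 with x ∈ A, ‖ρ A‖ * Real.exp ((1 + δ) * A.card) := by
                rw [Finset.sum_comm' (t' := γ) (s' := fun x => 𝒜.filter fun A => x ∈ A)]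
                intro A x
                simp only [Finset.mem_filter]
                tauto
      _ ≤ ∑ _x ∈ γ, (1 : ℝ) := Finset.sum_le_sum fun x _ =>
          h.sum_le_one x _ fun A hA => (Finset.mem_filter.1 hA).2
      _ = γ.card := by simp
  exact ⟨summable_of_sum_le hnn key, Real.tsum_le_of_sum_le hnn key⟩

/-- Every finite volume is a Kotecký–Preiss volume for `a = |·|`. [cite: KoteckyPreiss1986, Theorem p. 492, hypothesis (1)] -/
theorem isKPVolume (h : IsSmallActivity ρ δ) (𝒱 : Finset (Finset α)) :
    IsKPVolume polyInc ρ (fun A : Finset α => (A.card : ℝ)) 𝒱 :=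
  isKPVolume_of_tsum_le (inc := polyInc) (w := ρ) (a := fun A : Finset α => (A.card : ℝ))
    (d := fun A : Finset α => δ * (A.card : ℝ))
    (fun _ => mul_nonneg h.delta_pos.le (Nat.cast_nonneg _)) (fun γ => h.kp_hypothesis γ) 𝒱

/-- **Zero-freeness**: no finite-volume partition function vanishes. [cite: KoteckyPreiss1986, Theorem p. 492 (Z ≠ 0)] -/
theorem polymerPartitionFunction_ne_zero (h : IsSmallActivity ρ δ) (𝒱 : Finset (Finset α)) :
    polymerPartitionFunction polyInc ρ 𝒱 ≠ 0 :=
  polymerPartitionFunction_ne_zero_of_kp (h.isKPVolume 𝒱) Finset.Subset.rfl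

/-- **The Kotecký–Preiss branch is a logarithm** in every finite volume: `exp (log Ξ(𝒱)) = Ξ(𝒱)`.
[cite: KoteckyPreiss1986, Theorem p. 492 (Z ≠ 0 and (2))] -/
theorem exp_polymerLogZ (h : IsSmallActivity ρ δ) (𝒱 : Finset (Finset α)) :
    Complex.exp (polymerLogZ polyInc ρ 𝒱) = polymerPartitionFunction polyInc ρ 𝒱 :=
  exp_polymerLogZ_of_kp (h.isKPVolume 𝒱) Finset.Subset.rfl

/-- A family with non-zero truncated functional is a cluster. [cite: KoteckyPreiss1986, Theorem p. 492 (last assertion)] -/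
theorem isPolymerCluster_of_ne_zero (h : IsSmallActivity ρ δ) {C : Finset (Finset α)}
    (hC : truncatedWeight polyInc ρ C ≠ 0) : IsPolymerCluster polyInc C := by
  by_contra hCl
  exact hC (truncatedWeight_eq_zero_of_kp (h.isKPVolume C) Finset.Subset.rfl hCl)

omit [DecidableEq α] in
/-- Members of a family with non-zero truncated functional have non-zero activity. [folklore] -/
theorem ne_zero_of_mem_of_ne_zero [DecidableEq α] {C : Finset (Finset α)} (hC : truncatedWeight polyInc ρ C ≠ 0)
    {A : Finset α} (hA : A ∈ C) : ρ A ≠ 0 :=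
  fun h0 => hC (truncatedWeight_eq_zero_of_mem_of_eq_zero hA h0)

/-- **The Kotecký–Preiss estimate at a one-site polymer**: `Σ_{C : x ∈ ⋃C} |Φ^T(C)| e^{δ‖C‖} ≤ 1`,
`‖C‖ = Σ_{A ∈ C} |A|`. [cite: KoteckyPreiss1986, Theorem p. 492, estimate (4)] -/
theorem kp_singleton [Countable α] (h : IsSmallActivity ρ δ) (x : α) :
    Summable (fun C : {C : Finset (Finset α) // KPTouches polyInc C {x}} =>
        ‖truncatedWeight polyInc ρ C‖ * Real.exp (∑ A ∈ (C : Finset (Finset α)), δ * A.card)) ∧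
      ∑' C : {C : Finset (Finset α) // KPTouches polyInc C {x}},
        ‖truncatedWeight polyInc ρ C‖ * Real.exp (∑ A ∈ (C : Finset (Finset α)), δ * A.card) ≤ 1 := by
  have hfact := koteckyPreiss_truncatedWeight_bound_holds polyInc ρ
    (fun A => (A.card : ℝ)) (fun A => δ * A.card) (fun _ => Nat.cast_nonneg _)
    (fun A => mul_nonneg h.delta_pos.le (Nat.cast_nonneg _)) (fun γ => h.kp_hypothesis γ) {x}
  simpa using hfact

/-- **Anchored sums are bounded**: for any finite family of families, `Σ_{C : x ∈ ⋃C} |Φ^T(C)| ≤ 1`.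
[cite: KoteckyPreiss1986, Theorem p. 492, estimate (4)] -/
theorem sum_norm_truncatedWeight_anchored_le [Countable α] (h : IsSmallActivity ρ δ) (x : α)
    (𝒞 : Finset (Finset (Finset α))) :
    ∑ C ∈ 𝒞 with x ∈ clusterSupp C, ‖truncatedWeight polyInc ρ C‖ ≤ 1 := by
  classical
  have hb := sum_norm_truncatedWeight_le_of_touches (inc := polyInc) (w := ρ)
    (koteckyPreiss_truncatedWeight_bound_holds polyInc ρ (fun A : Finset α => (A.card : ℝ)) (fun A => δ * A.card))
    (fun _ => Nat.cast_nonneg _) (fun A => mul_nonneg h.delta_pos.le (Nat.cast_nonneg _))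
    (fun γ => h.kp_hypothesis γ) 𝒞 {x}
  have hset : (𝒞.filter fun C => x ∈ clusterSupp C) = 𝒞.filter fun C => KPTouches polyInc C {x} :=
    Finset.filter_congr fun C _ => kpTouches_polyInc_singleton_iff.symm
  rw [hset]
  simpa using hb

/-- **The anchored tail bound**: for any finite family of families, the ones through `x` of total
size `‖C‖ ≥ R` have `Σ |Φ^T(C)| ≤ e^{-δR}`. [cite: KoteckyPreiss1986, Theorem p. 492, estimate (4)] -/
theorem sum_norm_truncatedWeight_anchored_ge_le [Countable α] (h : IsSmallActivity ρ δ) (x : α)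
    (𝒞 : Finset (Finset (Finset α))) (R : ℝ) :
    ∑ C ∈ 𝒞 with (x ∈ clusterSupp C ∧ R ≤ ∑ A ∈ C, (A.card : ℝ)), ‖truncatedWeight polyInc ρ C‖ ≤
      Real.exp (-(δ * R)) := by
  classical
  set 𝒞' := 𝒞.filter fun C => R ≤ ∑ A ∈ C, (A.card : ℝ) with h𝒞'
  have hb := sum_norm_truncatedWeight_le_exp_neg_of_touches (inc := polyInc) (w := ρ)
    (koteckyPreiss_truncatedWeight_bound_holds polyInc ρ (fun A : Finset α => (A.card : ℝ)) (fun A => δ * A.card))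
    (fun _ => Nat.cast_nonneg _) (fun A => mul_nonneg h.delta_pos.le (Nat.cast_nonneg _))
    (fun γ => h.kp_hypothesis γ) 𝒞' {x} (r := δ * R) (fun C hC _ => by
      rw [← Finset.mul_sum]
      exact mul_le_mul_of_nonneg_left (Finset.mem_filter.1 hC).2 h.delta_pos.le)
  have hset : (𝒞.filter fun C => x ∈ clusterSupp C ∧ R ≤ ∑ A ∈ C, (A.card : ℝ)) =
      𝒞'.filter fun C => KPTouches polyInc C {x} := by
    rw [h𝒞', Finset.filter_filter]
    exact Finset.filter_congr fun C _ => by rw [kpTouches_polyInc_singleton_iff, and_comm]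
  rw [hset]
  simpa using hb

end IsSmallActivity

end Small

/-! ### Geometry of anchored clusters for an arbitrary step relation -/

section Geometry

variable {α : Type*} [DecidableEq α] {R : α → α → Prop}

/-- **Supports of clusters of connected sets are connected** (general step relation `R`): if `C`
is a cluster for the meet-or-equal incompatibility and every member is `R`-connected, then any
two sites of `⋃ C` are joined by an `R`-path inside `⋃ C`. [folklore] -/
theorem reflTransGen_clusterSupp_of_isPolymerCluster' {C : Finset (Finset α)}
    (hCl : IsPolymerCluster polyInc C) (hconn : ∀ A ∈ C, IsRConnected R A)
    {v w : α} (hv : v ∈ clusterSupp C) (hw : w ∈ clusterSupp C) :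
    Relation.ReflTransGen (fun a b => R a b ∧ a ∈ clusterSupp C ∧ b ∈ clusterSupp C) v w := by
  classical
  -- the set of sites reachable from `v` inside `clusterSupp C`
  set Rch : α → Prop := fun u =>
    Relation.ReflTransGen (fun a b => R a b ∧ a ∈ clusterSupp C ∧ b ∈ clusterSupp C) v u with hRch
  -- a connected member meeting the reachable set is entirely reachable
  have hlift : ∀ A ∈ C, ∀ u ∈ A, ∀ u' ∈ A, Rch u → Rch u' := by
    intro A hA u hu u' hu' hRu
    have hAs : A ⊆ clusterSupp C := subset_clusterSupp hA
    have hpath := (hconn A hA).2 u hu u' hu'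
    have hmono := Relation.ReflTransGen.mono (r := fun a b => R a b ∧ a ∈ A ∧ b ∈ A)
      (p := fun a b => R a b ∧ a ∈ clusterSupp C ∧ b ∈ clusterSupp C)
      fun a b hab => ⟨hab.1, hAs hab.2.1, hAs hab.2.2⟩
    exact hRu.trans (hmono u u' hpath)
  by_contra hvw
  set C₁ : Finset (Finset α) := C.filter fun A => ∀ u ∈ A, Rch u with hC₁
  obtain ⟨A₀, hA₀, hvA₀⟩ := mem_clusterSupp.1 hv
  obtain ⟨A₁, hA₁, hwA₁⟩ := mem_clusterSupp.1 hw
  have hA₀C₁ : A₀ ∈ C₁ := Finset.mem_filter.2 ⟨hA₀, fun u hu => hlift A₀ hA₀ v hvA₀ u hu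
    Relation.ReflTransGen.refl⟩
  have hA₁C₁ : A₁ ∉ C₁ := fun h1 => hvw ((Finset.mem_filter.1 h1).2 w hwA₁)
  obtain ⟨γ₁, hγ₁, γ₂, hγ₂, hinc⟩ := hCl C₁ (Finset.filter_subset _ _) ⟨A₀, hA₀C₁⟩
    ⟨A₁, Finset.mem_sdiff.2 ⟨hA₁, hA₁C₁⟩⟩
  obtain ⟨hγ₂C, hγ₂C₁⟩ := Finset.mem_sdiff.1 hγ₂
  have hγ₁R : ∀ u ∈ γ₁, Rch u := (Finset.mem_filter.1 hγ₁).2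
  rcases hinc with hEq | ⟨u, hu⟩
  · exact hγ₂C₁ (hEq ▸ hγ₁)
  · obtain ⟨hu₁, hu₂⟩ := Finset.mem_inter.1 hu
    exact hγ₂C₁ (Finset.mem_filter.2 ⟨hγ₂C, fun u' hu' => hlift γ₂ hγ₂C u hu₂ u' hu' (hγ₁R u hu₁)⟩)

omit [DecidableEq α] in
/-- **Discrete intermediate values.** Let `ht : α → ℕ` grow by at most one along `R`-steps. An
`R`-path inside a finite set `S` from a site of height `0` to a site of height `h` visits every
level `≤ h`, so `S` has at least `h + 1` sites. [folklore] -/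
theorem height_succ_le_card_of_reflTransGen [DecidableEq α] {ht : α → ℕ} (hlip : ∀ a b, R a b → ht b ≤ ht a + 1)
    {S : Finset α} {x w : α} (hx : x ∈ S) (hx0 : ht x = 0)
    (hw : Relation.ReflTransGen (fun a b => R a b ∧ a ∈ S ∧ b ∈ S) x w) :
    ht w + 1 ≤ S.card := by
  -- every level `j ≤ ht w` is attained in `S`
  have hlev : ∀ j ≤ ht w, ∃ u ∈ S, ht u = j := by
    induction hw with
    | refl =>
      intro j hj
      refine ⟨x, hx, ?_⟩
      omega
    | @tail a b _ hab ih =>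
      obtain ⟨hadj, -, hbS⟩ := hab
      intro j hj
      by_cases hja : j ≤ ht a
      · exact ih j hja
      · refine ⟨b, hbS, ?_⟩
        have h1 := hlip a b hadj
        omega
  have hsub : Finset.range (ht w + 1) ⊆ S.image ht := by
    intro j hj
    rw [Finset.mem_range, Nat.lt_succ_iff] at hj
    obtain ⟨u, hu, huj⟩ := hlev j hj
    exact Finset.mem_image.2 ⟨u, hu, huj⟩
  calc ht w + 1 = (Finset.range (ht w + 1)).card := by simp
    _ ≤ (S.image ht).card := Finset.card_le_card hsub
    _ ≤ S.card := Finset.card_image_le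

/-- **Anchored clusters of bounded size stay near the anchor.** Let `ht` grow by at most one along
`R` and vanish at `x`. If `C` is a cluster (for `polyInc`) of `R`-connected polymers whose support
contains `x`, then every site `w` of the support has `ht w + 1 ≤ |⋃ C| ≤ ‖C‖ = Σ_{A ∈ C} |A|`.
[folklore] -/
theorem height_succ_le_sum_card_of_mem_clusterSupp {ht : α → ℕ} (hlip : ∀ a b, R a b → ht b ≤ ht a + 1)
    {C : Finset (Finset α)} (hCl : IsPolymerCluster polyInc C) (hconn : ∀ A ∈ C, IsRConnected R A)
    {x : α} (hx : x ∈ clusterSupp C) (hx0 : ht x = 0) {w : α} (hw : w ∈ clusterSupp C) :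
    ht w + 1 ≤ ∑ A ∈ C, A.card :=
  (height_succ_le_card_of_reflTransGen hlip hx hx0
    (reflTransGen_clusterSupp_of_isPolymerCluster' hCl hconn hx hw)).trans (card_clusterSupp_le_sum_card C)

/-- The same for a SMALL ACTIVITY living on `R`-connected polymers: every site of the support of
a family `C` through `x` with `Φ^T(C) ≠ 0` has height `< ‖C‖`. [folklore] -/
theorem IsSmallActivity.height_lt_of_mem_clusterSupp {ρ : Finset α → ℂ} {δ : ℝ} (h : IsSmallActivity ρ δ)
    (hρ : ∀ A, ρ A ≠ 0 → IsRConnected R A) {ht : α → ℕ} (hlip : ∀ a b, R a b → ht b ≤ ht a + 1)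
    {C : Finset (Finset α)} (hC : truncatedWeight polyInc ρ C ≠ 0) {x : α} (hx : x ∈ clusterSupp C)
    (hx0 : ht x = 0) {w : α} (hw : w ∈ clusterSupp C) :
    ht w < ∑ A ∈ C, A.card :=
  Nat.lt_of_succ_le (height_succ_le_sum_card_of_mem_clusterSupp hlip (h.isPolymerCluster_of_ne_zero hC)
    (fun A hA => hρ A (IsSmallActivity.ne_zero_of_mem_of_ne_zero hC hA)) hx hx0 hw)

end Geometry

end Literature.Probability.LatticeModels

end
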